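import Summits.AtomisticToContinuum.HydrodynamicLimit.Theorems.CollisionIsometryCLTCollisionalTransferLocalityDefsB
import Summits.AtomisticToContinuum.HydrodynamicLimit.Theorems.CollisionIsometryCLTCollisionalTransferLocalityBalanceIdentity
import Summits.AtomisticToContinuum.HydrodynamicLimit.Theorems.CollisionIsometryCLTCollisionalTransferLocalityMarkedReduction
import Summits.AtomisticToContinuum.HydrodynamicLimit.Theorems.CollisionIsometryCLTCollisionalTransferLocalityChannelAdditivity
import HarnessLib

/-!
# The channel split of the crux's conclusion (line `hemisphere-affine-slaving`, crux `CollisionalTransferLocality`,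
stmt-AtomisticToContinuum-9518)

Support file (`--supports stmt-AtomisticToContinuum-9518`) of the line lead (gen 1, seat c9). The crux's residual `Cc`, the mark sum
`M_N`, and the values `Rhs`, `Kfun` are linear in the pair of tests `(ψ, χ)`, so the crux at `(ψ, χ)` is the conjunction of a
MOMENTUM statement (`χ ≡ 0`) and an ENERGY statement (`ψ ≡ 0`). This file records the glue the skeleton's compositions use to make
that split at the level of the crux's CONCLUSION (on the dilute ∩ good event — exact additivity of `Rhs` fails by Bochner junk):
* `DiluteAt.mono` — the dilute event is monotone in the level;
* `isSmoothSpaceTimeOn_zero_scalar`, `isSmoothSpaceTimeOn_zero_vector` — the zero tests are space–time smooth;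
* `conclusion_step'` — one pair of tests: [V] + marked law at `p_c` + [C] ⇒ conclusion ([S1] + `stub_markedReduction`, landed);
* `conclusion_of_channels` — marked law + [C] in EACH channel ⇒ conclusion at `(ψ, χ)` (two steps + the landed [G2]
  `stub_channelAdditivity`, p139073).
All sorry-free; nothing is asserted.
-/

namespace Summit.AtomisticToContinuum.HydrodynamicLimit.Theorems.HemisphereAffineSlaving

open scoped BigOperators Topology Classical ENNReal InnerProductSpace
open Filter Set Function MeasureTheory

noncomputable section

open Literature.MathematicalPhysics.KineticTheory (T3 V3)

/-- The zero scalar test is space–time smooth. [folklore] -/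
theorem isSmoothSpaceTimeOn_zero_scalar (S : Set ℝ) :
    Literature.Analysis.FunctionSpaces.Torus.IsSmoothSpaceTimeOn S (fun (_ : ℝ) (_ : T3) => (0 : ℝ)) :=
  Literature.Analysis.FunctionSpaces.Torus.isSmoothSpaceTimeOn_const
    (Literature.Analysis.FunctionSpaces.Torus.isSmooth_const (0 : ℝ)) S

/-- The zero vector test is space–time smooth. [folklore] -/
theorem isSmoothSpaceTimeOn_zero_vector (S : Set ℝ) :
    Literature.Analysis.FunctionSpaces.Torus.IsSmoothSpaceTimeOn S (fun (_ : ℝ) (_ : T3) => (0 : V3)) :=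
  Literature.Analysis.FunctionSpaces.Torus.isSmoothSpaceTimeOn_const
    (Literature.Analysis.FunctionSpaces.Torus.isSmooth_const (0 : V3)) S

/-- The dilute event is monotone in the level: a lower ceiling is a smaller event. [folklore] -/
theorem DiluteAt.mono {σ : ℝ} {a₀ θ₀ : T3 → ℝ} {u₀ : T3 → V3} {Φ : Flows σ} {t : ℝ} {φ : ℕ → T3 → ℝ} {η η' : ℝ}
    (hle : η ≤ η') (h : DiluteAt σ a₀ θ₀ u₀ Φ t φ η) : DiluteAt σ a₀ θ₀ u₀ Φ t φ η' := by
  refine tendsto_of_tendsto_of_tendsto_of_le_of_le tendsto_const_nhds h (fun N => bot_le)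
    (fun N => measure_mono ?_)
  rintro z ⟨s, hs, x, hx⟩
  exact ⟨s, hs, x, hle.trans_lt hx⟩

/-- **One step of the skeleton's compositions, one pair of tests.** At fixed `(σ, profiles, Φ)` with `0 < σ ≤ 1/2`, a kernel family, a
horizon `t > 0`, smooth tests `(ψ, χ)` on `[0, t]`, [V] `VirialBounded`, the marked law [M] at the collisional pressure (`M_N − (Rhs + Kfun) → 0`
uniformly in `τ ≤ t`, in probability) and [C] `RelaxC` at this `(kernel, t, ψ, χ)`: the crux's conclusion at this `(kernel, t, ψ, χ)` —
[S1] `stub_balanceIdentity` and the reduction `stub_markedReduction` (both landed). [folklore] -/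
theorem conclusion_step' {σ : ℝ} (hσ : 0 < σ) (hhalf : σ ≤ 1 / 2) (a₀ θ₀ : T3 → ℝ)
    (u₀ : T3 → V3) (Φ : Flows σ) (φ : ℕ → T3 → ℝ) {t : ℝ} (ht : 0 < t)
    {ψ : ℝ → T3 → V3} {χ : ℝ → T3 → ℝ}
    (hψ : Literature.Analysis.FunctionSpaces.Torus.IsSmoothSpaceTimeOn (Icc 0 t) ψ)
    (hχ : Literature.Analysis.FunctionSpaces.Torus.IsSmoothSpaceTimeOn (Icc 0 t) χ)
    (hV : VirialBounded σ a₀ θ₀ u₀ Φ t)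
    (hM : ∀ δ : ℝ, 0 < δ → Tendsto (fun N : ℕ =>
      Literature.MathematicalPhysics.KineticTheory.localGibbsLaw σ a₀ u₀ θ₀ N (Φ N)
        {z | ∃ τ ∈ Icc 0 t, δ < |Mfun σ Φ ψ χ N z τ - (Rhs σ Φ φ ψ χ N z τ + Kfun σ Φ φ ψ χ N z τ)|})
          atTop (𝓝 0))
    (hC : RelaxC σ a₀ θ₀ u₀ Φ φ t ψ χ) :
    ∀ δ : ℝ, 0 < δ → Tendsto (fun N : ℕ =>
      Literature.MathematicalPhysics.KineticTheory.localGibbsLaw σ a₀ u₀ θ₀ N (Φ N)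
        {z | ∃ τ ∈ Icc 0 t, δ < |Cc σ Φ ψ χ N z τ - Rhs σ Φ φ ψ χ N z τ|}) atTop (𝓝 0) :=
  Summit.AtomisticToContinuum.HydrodynamicLimit.Theorems.HemisphereAffineSlaving.stub_markedReduction σ hσ hhalf a₀ θ₀ u₀ Φ (stub_balanceIdentity σ hσ hhalf Φ) φ ht hψ hχ hV hM hC

/-- **THE CHANNEL SPLIT OF THE CRUX'S CONCLUSION.** At fixed `(σ, profiles, Φ)` with `0 < σ ≤ 1/2`, the linear `Z`-bound
`|Z(η) − 1| ≤ Kη` on `[0, η_Z]`, a dilute level `η₁ ≤ η_Z` with the dilute event `DiluteAt … η₁`, continuous nonnegative kernels, a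
horizon `t > 0`, smooth tests `ψ`, `χ` on `[0, t]`, [V], the marked law at the collisional pressure in EACH CHANNEL — momentum `(ψ, 0)`
and energy `(0, χ)` — and [C] in each channel: the crux's conclusion at `(ψ, χ)`. Two calls of `conclusion_step'` and the landed glue
[G2] `stub_channelAdditivity` (p139073). This is the lemma through which the two engine statements of the crux (the mesoscale
collisional-stress law and the mesoscale collisional-energy-flux law, registered stubs `stub_collisionalStressLaw` /
`stub_collisionalEnergyFluxLaw` of the skeleton `Cruxes/CollisionalTransferLocality/Lines/hemisphere_affine_slaving.lean`) close it. [folklore] -/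
theorem conclusion_of_channels : ∀ {σ : ℝ}, 0 < σ → σ ≤ 1 / 2 → ∀ {ηZ K : ℝ}, 0 < ηZ → 0 ≤ K → (∀ η : ℝ, 0 ≤ η → η ≤ ηZ → |Literature.MathematicalPhysics.KineticTheory.hsCompressibility η - 1| ≤ K * η) → ∀ {η₁ : ℝ}, 0 < η₁ → η₁ ≤ ηZ → ∀ (a₀ θ₀ : T3 → ℝ) (u₀ : T3 → V3) (Φ : Flows σ) (φ : ℕ → T3 → ℝ) {t : ℝ}, 0 < t → (∀ N, Continuous (φ N)) → (∀ N y, 0 ≤ φ N y) → DiluteAt σ a₀ θ₀ u₀ Φ t φ η₁ → ∀ {ψ : ℝ → T3 → V3} {χ : ℝ → T3 → ℝ}, Literature.Analysis.FunctionSpaces.Torus.IsSmoothSpaceTimeOn (Icc 0 t) ψ → Literature.Analysis.FunctionSpaces.Torus.IsSmoothSpaceTimeOn (Icc 0 t) χ → VirialBounded σ a₀ θ₀ u₀ Φ t → (∀ δ : ℝ, 0 < δ → Tendsto (fun N : ℕ => Literature.MathematicalPhysics.KineticTheory.localGibbsLaw σ a₀ u₀ θ₀ N (Φ N) {z | ∃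 τ ∈ Icc 0 t, δ < |Mfun σ Φ ψ (fun (_ : ℝ) (_ : T3) => (0 : ℝ)) N z τ - (Rhs σ Φ φ ψ (fun (_ : ℝ) (_ : T3) => (0 : ℝ)) N z τ + Kfun σ Φ φ ψ (fun (_ : ℝ) (_ : T3) => (0 : ℝ)) N z τ)|}) atTop (𝓝 0)) → (∀ δ : ℝ, 0 < δ → Tendsto (fun N : ℕ => Literature.MathematicalPhysics.KineticTheory.localGibbsLaw σ a₀ u₀ θ₀ N (Φ N) {z | ∃ τ ∈ Icc 0 t, δ < |Mfun σ Φ (fun (_ : ℝ) (_ : T3) => (0 : V3)) χ N z τ - (Rhs σ Φ φ (fun (_ : ℝ) (_ : T3) => (0 : V3)) χ N z τ + Kfun σ Φ φ (fun (_ : ℝ) (_ : T3) => (0 : V3)) χ N z τ)|}) atTop (𝓝 0)) → RelaxC σ a₀ θ₀ u₀ Φ φ t ψ (fun (_ : ℝ) (_ : T3) => (0 : ℝ)) → RelaxC σ a₀ θ₀ u₀ Φ φ t (fun (_ : ℝ) (_ : T3) => (0 : V3)) χ → ∀ δ : ℝ, 0 < δ → Tendsto (fun N : ℕ => Literature.MathematicalPhysics.KineticTheory.localGibbsLaw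 σ a₀ u₀ θ₀ N (Φ N) {z | ∃ τ ∈ Icc 0 t, δ < |Cc σ Φ ψ χ N z τ - Rhs σ Φ φ ψ χ N z τ|}) atTop (𝓝 0) := by
  intro σ hσ hhalf ηZ K hηZ hK hZK η₁ hη₁0 hη₁Z a₀ θ₀ u₀ Φ φ t ht hφc hφ0 hDil ψ χ hψ hχ hV hMψ hMχ hCψ hCχ
  exact stub_channelAdditivity σ hσ hhalf ηZ K hηZ hK hZK η₁ hη₁0 hη₁Z a₀ θ₀ u₀ Φ φ t ht hφc hφ0 hDil ψ χ hψ hχ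
    (conclusion_step' hσ hhalf a₀ θ₀ u₀ Φ φ ht hψ (isSmoothSpaceTimeOn_zero_scalar _) hV hMψ hCψ)
    (conclusion_step' hσ hhalf a₀ θ₀ u₀ Φ φ ht (isSmoothSpaceTimeOn_zero_vector _) hχ hV hMχ hCχ)


end

end Summit.AtomisticToContinuum.HydrodynamicLimit.Theorems.HemisphereAffineSlaving
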